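import Summits.KontsevichZagierPeriods.KontsevichZagierPeriods.Theses.ComplexOrientations
import Summits.KontsevichZagierPeriods.KontsevichZagierPeriods.Theses.AbelContraction
import Summits.KontsevichZagierPeriods.KontsevichZagierPeriods.Theorems.ComplexOrientationsCauchyMove
import Summits.KontsevichZagierPeriods.KontsevichZagierPeriods.Theorems.ComplexOrientationsKernelFormGlue
import Summits.KontsevichZagierPeriods.KontsevichZagierPeriods.Theorems.ComplexOrientationsOrientationKernelSectorReductionNecessity
import Summits.KontsevichZagierPeriods.KontsevichZagierPeriods.Theorems.AbelContractionAreasToArcs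
import Literature.AlgebraicGeometry.RealAlgebraic.DividingCurves
import Literature.NumberTheory.Transcendental.KZKernelConjectureForms

/-!
# Crux `OrientationKernel` (stmt-KontsevichZagierPeriods-11367): exactness of route
`ComplexOrientations` — the summit is `OrientationKernel ∧ OvalSector`, and two of the crux's
three relator families are redundant

The route `ComplexOrientations` decides the summit by
`closes : TypeOneIdentities → OvalSector → CauchyMove → OrientationKernel → KontsevichZagierPeriods`,
and `KernelFormGlue` records `kernel form → OrientationKernel`. This file makes the decomposition
EXACT in the tree (pure logic over landed theorems; no analysis beyond "a complex-smooth curve is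
real-smooth"):

* `realSmooth_of_complexSmooth` — if `∇p ≠ 0` at every complex zero of `p ∈ ℚ[x, y]`, then
  `∇p ≠ 0` at every real zero (evaluation at a real point commutes with `ℝ ⊆ ℂ`,
  `Literature.AlgebraicGeometry.RealAlgebraic.aeval_ofReal`);
* `typeOneIdentities_of_ovalSector` — **`OvalSector → TypeOneIdentities`**: the type-I unit-sign
  oval identities (family (i)) are among the integer oval-sector identities (family (ii)); the
  route's engine `TypeOneIdentities` is a special case of its crux `OvalSector`, not an
  independent hypothesis of `closes`;
* `orientationKernel_iff_ovalKernel` — **the crux is equivalent to its family-(ii)-only form**: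
  in `OrientationKernel` the hypotheses that `R` contains family (i) (implied by family (ii)) and
  family (iii) (the Cauchy relators lie in `KZ.relations ≤ R`, `cauchyMove_proof`, landed) can be
  dropped;
* `kernelForm_iff_orientationKernel_and_ovalSector` — the plain kernel form of Conjecture 1
  (`∀ x, KZ.eval x = 0 → x ∈ KZ.relations`) is EQUIVALENT to `OrientationKernel ∧ OvalSector`;
* `kontsevichZagierPeriods_iff_orientationKernel_and_ovalSector` — hence
  **`KontsevichZagierPeriods ↔ OrientationKernel ∧ OvalSector`** (through
  `kzKernelConjecture_iff_isRational`): the route's cone is exactly the summit, split into the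
  enlarged-kernel crux and the oval sector;
* `planarAreas_of_orientationKernel_of_ovalSector`,
  `reductionToDimensionOne_of_orientationKernel_of_ovalSector` — in particular both stubs of line
  `birth` (`PlanarAreas` = stmt-4990, `ReductionToDimensionOne` = stmt-14403) are necessary for
  `OrientationKernel ∧ OvalSector`;
* `ovalSector_of_boundedPlanarKernel`, `ovalSector_of_planarAreas`,
  `typeOneIdentities_of_planarAreas` — conversely the planar kernel (already its bounded form)
  gives `OvalSector` and `TypeOneIdentities` (the route's kill criterion "PlanarAreas proved ⇒
  both follow" as a theorem: the oval combinations lie in the 1-period sector,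
  `ovalCombination_mem_sup_sector`, whose kernel the bounded planar kernel settles through the
  landed merge, `sector_mem_relations_of_boundedPlanarKernel`);
* `kontsevichZagierPeriods_iff_reductionToDimensionOne_of_planarAreas` — under the 1-period layer
  `PlanarAreas` the summit, the crux and stmt-14403 are one statement.

Together with the landed `reductionToDimensionOne_of_orientationKernel` (the crux alone implies
stmt-14403) and `orientationKernel_of_reductionToDimensionOne_of_planarAreas` (the registered
composition of line `birth`), the logical position of the crux is now completely recorded:
`summit ↔ OrientationKernel ∧ OvalSector`, `OrientationKernel → ReductionToDimensionOne`,
`ReductionToDimensionOne ∧ PlanarAreas → OrientationKernel ∧ OvalSector`,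
`OrientationKernel ∧ OvalSector → PlanarAreas`.

References: M. Kontsevich, D. Zagier, *Periods* (2001), §1.2 (Conjecture 1 and its kernel form);
A. Degtyarev, V. Kharlamov, *Topological properties of real algebraic varieties* (2000), §1
(type I curves). No definitions, no named facts.
-/

noncomputable section

open Literature.NumberTheory.Transcendental

namespace Summit.KontsevichZagierPeriods.ComplexOrientations.OrientationKernel

/-- **A complex-smooth plane curve is real-smooth.** If at every complex zero `w` of
`p ∈ ℚ[x, y]` some partial derivative `∂p/∂xᵢ (w)` is non-zero, then the same holds at every
real zero `v`: the complex evaluation at the real point `v` is the real evaluation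
(`aeval_ofReal`). [folklore] -/
theorem realSmooth_of_complexSmooth (p : MvPolynomial (Fin 2) ℚ)
    (h : ∀ w : Fin 2 → ℂ, MvPolynomial.aeval w p = 0 →
      ∃ i, MvPolynomial.aeval w (MvPolynomial.pderiv i p) ≠ 0) :
    ∀ v : Fin 2 → ℝ, MvPolynomial.aeval v p = 0 →
      ∃ i, MvPolynomial.aeval v (MvPolynomial.pderiv i p) ≠ 0 := by
  intro v hv
  obtain ⟨i, hi⟩ := h (fun j => (v j : ℂ)) (by
    rw [Literature.AlgebraicGeometry.RealAlgebraic.aeval_ofReal, hv, Complex.ofReal_zero])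
  refine ⟨i, fun h0 => hi ?_⟩
  rw [Literature.AlgebraicGeometry.RealAlgebraic.aeval_ofReal, h0, Complex.ofReal_zero]

/-- **`OvalSector → TypeOneIdentities`**: the type-I unit-sign oval identities of a dividing,
geometrically irreducible, complex-smooth compact real plane curve (route item
`TypeOneIdentities`, stmt-11368) are instances of the integer oval-sector identities of a
real-smooth compact curve (route item `OvalSector`, stmt-11369): take `n := η`, forget the
dividing and irreducibility hypotheses, and pass from complex to real smoothness
(`realSmooth_of_complexSmooth`). [Kontsevich–Zagier 2001, §1.2] -/
theorem typeOneIdentities_of_ovalSector :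
    Summit.KontsevichZagierPeriods.KontsevichZagierPeriods.Theses.ComplexOrientations.OvalSector →
    Summit.KontsevichZagierPeriods.KontsevichZagierPeriods.Theses.ComplexOrientations.TypeOneIdentities := by
  intro hOS p hcpt hsm _ _ k O s hO hinj hcov hdom hint η β e _ hβ hβ0 hedom heint hval
  exact hOS p hcpt (realSmooth_of_complexSmooth p hsm) k O s hO hinj hcov hdom hint η β e hβ hβ0
    hedom heint hval

/-- **The crux is its family-(ii)-only form.** `OrientationKernel` is equivalent to: every
subgroup `R ≥ KZ.relations` of `KZ.FormalRep` containing all integer oval-sector identities of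
one real-smooth compact plane curve against a `π`-carrier (family (ii)) contains `ker KZ.eval`.
The two other relator hypotheses of the crux are redundant: family (i) (type-I unit-sign
identities) is contained in family (ii) (`realSmooth_of_complexSmooth`), and family (iii) (the
Cauchy relators) lies in `KZ.relations ≤ R` by the landed `cauchyMove_proof`.
[Kontsevich–Zagier 2001, §1.2] -/
theorem orientationKernel_iff_ovalKernel :
    Summit.KontsevichZagierPeriods.KontsevichZagierPeriods.Theses.ComplexOrientations.OrientationKernel ↔
    ∀ R : AddSubgroup KZ.FormalRep, KZ.relations ≤ R →
      (∀ (p : MvPolynomial (Fin 2) ℚ), IsCompact {v : Fin 2 → ℝ | MvPolynomial.aeval v p = 0} →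
        (∀ v : Fin 2 → ℝ, MvPolynomial.aeval v p = 0 →
          ∃ i, MvPolynomial.aeval v (MvPolynomial.pderiv i p) ≠ 0) →
        ∀ (k : ℕ) (O : Fin k → Set (Fin 2 → ℝ)) (s : Fin k → KZ.IntegralRep 2),
        (∀ i, ∃ v : Fin 2 → ℝ, MvPolynomial.aeval v p = 0 ∧
          O i = connectedComponentIn {u : Fin 2 → ℝ | MvPolynomial.aeval u p = 0} v) →
        Function.Injective O →
        (∀ v : Fin 2 → ℝ, MvPolynomial.aeval v p = 0 → ∃ i, v ∈ O i) →
        (∀ i, (s i).domain =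
          {v : Fin 2 → ℝ | v ∉ O i ∧ Bornology.IsBounded (connectedComponentIn (O i)ᶜ v)}) →
        (∀ i, ∀ v ∈ (s i).domain, (s i).integrand v = 1) →
        ∀ (n : Fin k → ℤ) (β : ℝ) (e : KZ.IntegralRep 2), IsAlgebraic ℚ β → 0 ≤ β →
        e.domain = {v : Fin 2 → ℝ | v 0 ^ 2 + v 1 ^ 2 < β} → (∀ v ∈ e.domain, e.integrand v = 1) →
        ∑ i, (n i : ℝ) * (s i).value = e.value → (∑ i, n i • KZ.of (s i)) - KZ.of e ∈ R) →
      ∀ x : KZ.FormalRep, KZ.eval x = 0 → x ∈ R := by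
  constructor
  · intro hK R hRel hII x hx
    refine hK R hRel ?_ hII ?_ x hx
    · intro p hcpt hsm _ _ k O s hO hinj hcov hdom hint η β e _ hβ hβ0 hedom heint hval
      exact hII p hcpt (realSmooth_of_complexSmooth p hsm) k O s hO hinj hcov hdom hint η β e hβ
        hβ0 hedom heint hval
    · intro ρ R' g hρ hρR halg hg hP r hdom hint
      exact hRel (Summit.KontsevichZagierPeriods.ComplexOrientations.cauchyMove_proof ρ R' g hρ
        hρR halg hg hP r hdom hint)
  · intro h R hRel _ hII _ x hx
    exact h R hRel hII x hx

/-- **Kernel form `↔ OrientationKernel ∧ OvalSector`.** The plain kernel form of Conjecture 1 for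
the calculus of moves — every formal `ℤ`-combination of integral representations with value `0`
lies in `KZ.relations` — is equivalent to the conjunction of the route's enlarged-kernel crux and
its oval-sector crux: `→` by monotonicity (`KernelFormGlue_proof`) and because every oval-sector
combination `∑ nᵢ [sᵢ] − [e]` with `∑ nᵢ · Area = Area e` has value `0`; `←` because under
`OvalSector` the subgroup `R := KZ.relations` itself is admissible for `OrientationKernel`
(families (i) ⊆ (ii) by `typeOneIdentities_of_ovalSector`, family (iii) by `cauchyMove_proof`) —
the deciding theorem `closes` read in kernel form. [Kontsevich–Zagier 2001, §1.2] -/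
theorem kernelForm_iff_orientationKernel_and_ovalSector :
    (∀ x : KZ.FormalRep, KZ.eval x = 0 → x ∈ KZ.relations) ↔
    Summit.KontsevichZagierPeriods.KontsevichZagierPeriods.Theses.ComplexOrientations.OrientationKernel ∧
    Summit.KontsevichZagierPeriods.KontsevichZagierPeriods.Theses.ComplexOrientations.OvalSector := by
  constructor
  · intro hK
    refine ⟨Summit.KontsevichZagierPeriods.ComplexOrientations.KernelFormGlue.KernelFormGlue_proof hK,
      ?_⟩
    intro p _ _ k O s _ _ _ _ _ n β e _ _ _ _ hval
    apply hK
    rw [map_sub, map_sum]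
    simp only [map_zsmul, KZ.eval_of, zsmul_eq_mul]
    rw [hval, sub_self]
  · rintro ⟨hK, hOS⟩ x hx
    exact hK KZ.relations le_rfl (typeOneIdentities_of_ovalSector hOS) hOS
      Summit.KontsevichZagierPeriods.ComplexOrientations.cauchyMove_proof x hx

/-- **The summit is `OrientationKernel ∧ OvalSector`.** `KontsevichZagierPeriods` (Conjecture 1 in
its two-representation form over KZ's literal rational shape) is equivalent to the kernel form
(`kzKernelConjecture_iff_isRational`: merge of formal combinations into differences and reduction
of algebraic to rational integrands, both landed), hence to `OrientationKernel ∧ OvalSector`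
(`kernelForm_iff_orientationKernel_and_ovalSector`). So route `ComplexOrientations` is an EXACT
decomposition of the summit: its engine `TypeOneIdentities` and support `CauchyMove` are
logically absorbed, and any refutation of either conjunct refutes the summit.
[Kontsevich–Zagier 2001, §1.2] -/
theorem kontsevichZagierPeriods_iff_orientationKernel_and_ovalSector :
    KontsevichZagierPeriods ↔
    Summit.KontsevichZagierPeriods.KontsevichZagierPeriods.Theses.ComplexOrientations.OrientationKernel ∧
    Summit.KontsevichZagierPeriods.KontsevichZagierPeriods.Theses.ComplexOrientations.OvalSector :=
  (KontsevichZagierPeriods_iff.trans kzKernelConjecture_iff_isRational.symm).trans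
    kernelForm_iff_orientationKernel_and_ovalSector

/-- **`OrientationKernel ∧ OvalSector → PlanarAreas`.** Under the two cruxes of the route the
kernel form holds (`kernelForm_iff_orientationKernel_and_ovalSector`), so two planar integrand-`1`
representations of equal area — whose difference has value `0` — are KZ-equivalent: the second
stub of line `birth` (`PlanarAreas`, stmt-4990) is necessary for the route's cone.
[Kontsevich–Zagier 2001, §1.2] -/
theorem planarAreas_of_orientationKernel_of_ovalSector
    (hK : Summit.KontsevichZagierPeriods.KontsevichZagierPeriods.Theses.ComplexOrientations.OrientationKernel)
    (hOS : Summit.KontsevichZagierPeriods.KontsevichZagierPeriods.Theses.ComplexOrientations.OvalSector) :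
    Summit.KontsevichZagierPeriods.KontsevichZagierPeriods.Theses.AbelContraction.PlanarAreas := by
  intro r r' _ _ hv
  have hker := kernelForm_iff_orientationKernel_and_ovalSector.2 ⟨hK, hOS⟩
  show KZ.of r - KZ.of r' ∈ KZ.relations
  apply hker
  rw [map_sub, KZ.eval_of, KZ.eval_of, hv, sub_self]

/-- **`OrientationKernel ∧ OvalSector → ReductionToDimensionOne`** directly through the kernel
form (monotonicity), complementing the landed `reductionToDimensionOne_of_orientationKernel`
(which needs `OrientationKernel` alone). [Kontsevich–Zagier 2001, §1.2] -/
theorem reductionToDimensionOne_of_orientationKernel_of_ovalSector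
    (hK : Summit.KontsevichZagierPeriods.KontsevichZagierPeriods.Theses.ComplexOrientations.OrientationKernel)
    (hOS : Summit.KontsevichZagierPeriods.KontsevichZagierPeriods.Theses.ComplexOrientations.OvalSector) :
    Summit.KontsevichZagierPeriods.KontsevichZagierPeriods.Theses.AbelContraction.ReductionToDimensionOne := by
  intro R hRel _ x hx
  exact hRel (kernelForm_iff_orientationKernel_and_ovalSector.2 ⟨hK, hOS⟩ x hx)

/-- **The bounded planar kernel gives `OvalSector`.** If any two BOUNDED planar representations
with integrand `1` and equal area are congruent modulo the moves, then every integer oval-sector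
identity `∑ nᵢ [sᵢ] − [e]` of a compact real plane curve against a `π`-carrier lies in
`KZ.relations`: the combination lies in the 1-period sector (`ovalCombination_mem_sup_sector`:
oval interiors of a compact curve and discs are bounded), has value `0` by the hypothesis
`∑ nᵢ · Area (sᵢ) = Area e`, and the sector's kernel is settled by the bounded planar kernel
(`sector_mem_relations_of_boundedPlanarKernel`, via the landed merge `stub_sectorMerge`). The
smoothness of the curve and the algebraicity of `β` are not used. [Kontsevich–Zagier 2001, §1.2] -/
theorem ovalSector_of_boundedPlanarKernel
    (h : ∀ A B : KZ.IntegralRep 2, Bornology.IsBounded A.domain → Bornology.IsBounded B.domain →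
      (∀ v ∈ A.domain, A.integrand v = 1) → (∀ v ∈ B.domain, B.integrand v = 1) →
      A.value = B.value → KZ.of A - KZ.of B ∈ KZ.relations) :
    Summit.KontsevichZagierPeriods.KontsevichZagierPeriods.Theses.ComplexOrientations.OvalSector := by
  intro p hcpt _ k O s hO _ _ hdom hint n β e _ _ hedom heint hval
  set S : AddSubgroup KZ.FormalRep := AddSubgroup.closure
    ({c : KZ.FormalRep | ∃ s : KZ.IntegralRep 0, c = KZ.of s} ∪
      {c : KZ.FormalRep | ∃ s : KZ.IntegralRep 1, c = KZ.of s} ∪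
      {c : KZ.FormalRep | ∃ s : KZ.IntegralRep 2, Bornology.IsBounded s.domain ∧
        (∀ v ∈ s.domain, s.integrand v = 1) ∧ c = KZ.of s}) with hS_def
  have planar_mem : ∀ s : KZ.IntegralRep 2, Bornology.IsBounded s.domain →
      (∀ v ∈ s.domain, s.integrand v = 1) → KZ.of s ∈ S :=
    fun s hb h1 => AddSubgroup.subset_closure (Or.inr ⟨s, hb, h1, rfl⟩)
  have hy : (∑ i, n i • KZ.of (s i)) - KZ.of e ∈ KZ.relations ⊔ S :=
    ovalCombination_mem_sup_sector S planar_mem p hcpt k O s hO hdom hint n β e hedom heint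
  have hval0 : KZ.eval ((∑ i, n i • KZ.of (s i)) - KZ.of e) = 0 := by
    rw [map_sub, map_sum]
    simp only [map_zsmul, KZ.eval_of, zsmul_eq_mul]
    rw [hval, sub_self]
  obtain ⟨c, hc, y, hyS, hsum⟩ := AddSubgroup.mem_sup.1 hy
  have hy0 : KZ.eval y = 0 := by
    have hc0 : KZ.eval c = 0 := KZ.relations_le_ker_eval_holds hc
    have h' := hval0
    rwa [← hsum, map_add, hc0, zero_add] at h'
  rw [← hsum]
  exact KZ.relations.add_mem hc (sector_mem_relations_of_boundedPlanarKernel h y hyS hy0)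

/-- **`PlanarAreas → OvalSector`** (the route's kill criterion "PlanarAreas (stmt-4990) proved ⇒
`TypeOneIdentities` and `OvalSector` follow: go dormant", as a theorem): specialise the planar
kernel to bounded domains (`boundedPlanarKernel_of_planarAreas`) and apply
`ovalSector_of_boundedPlanarKernel`; `TypeOneIdentities` then follows by
`typeOneIdentities_of_ovalSector`. [Kontsevich–Zagier 2001, §1.2] -/
theorem ovalSector_of_planarAreas
    (hP : Summit.KontsevichZagierPeriods.KontsevichZagierPeriods.Theses.AbelContraction.PlanarAreas) :
    Summit.KontsevichZagierPeriods.KontsevichZagierPeriods.Theses.ComplexOrientations.OvalSector :=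
  ovalSector_of_boundedPlanarKernel (boundedPlanarKernel_of_planarAreas hP)

/-- **`PlanarAreas → TypeOneIdentities`** (`ovalSector_of_planarAreas` and
`typeOneIdentities_of_ovalSector`). [Kontsevich–Zagier 2001, §1.2] -/
theorem typeOneIdentities_of_planarAreas
    (hP : Summit.KontsevichZagierPeriods.KontsevichZagierPeriods.Theses.AbelContraction.PlanarAreas) :
    Summit.KontsevichZagierPeriods.KontsevichZagierPeriods.Theses.ComplexOrientations.TypeOneIdentities :=
  typeOneIdentities_of_ovalSector (ovalSector_of_planarAreas hP)

/-- **Under the 1-period layer the route's two cruxes collapse to stmt-14403**: `PlanarAreas →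
(KontsevichZagierPeriods ↔ ReductionToDimensionOne)`. `→`: the summit gives `OrientationKernel`
(`kontsevichZagierPeriods_iff_orientationKernel_and_ovalSector`), which gives the reduction
(`reductionToDimensionOne_of_orientationKernel_of_ovalSector`); `←`: the reduction and
`PlanarAreas` give `OrientationKernel` (the registered composition of line `birth`, inlined: the
one-dimensional pairs are relations by `areasToArcs_proof`) and `PlanarAreas` gives `OvalSector`
(`ovalSector_of_planarAreas`). [Kontsevich–Zagier 2001, §1.2] -/
theorem kontsevichZagierPeriods_iff_reductionToDimensionOne_of_planarAreas
    (hP : Summit.KontsevichZagierPeriods.KontsevichZagierPeriods.Theses.AbelContraction.PlanarAreas) :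
    KontsevichZagierPeriods ↔
    Summit.KontsevichZagierPeriods.KontsevichZagierPeriods.Theses.AbelContraction.ReductionToDimensionOne := by
  rw [kontsevichZagierPeriods_iff_orientationKernel_and_ovalSector]
  constructor
  · rintro ⟨hK, hOS⟩
    exact reductionToDimensionOne_of_orientationKernel_of_ovalSector hK hOS
  · intro hred
    refine ⟨?_, ovalSector_of_planarAreas hP⟩
    intro R hRel _ _ _ x hx
    have hone : ∀ (r r' : KZ.IntegralRep 1), r.value = r'.value → KZ.Equivalent r r' :=
      Summit.KontsevichZagierPeriods.AbelContraction.AreasToArcs.areasToArcs_proof hP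
    exact hred R hRel (fun r r' hv => hRel (hone r r' hv)) x hx

end Summit.KontsevichZagierPeriods.ComplexOrientations.OrientationKernel

end
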